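import Literature.MathematicalPhysics.QuantumFieldTheory.Balaban1983to89.Beta.WindowIdentification

/-!
# `BalabanUV.Beta.D1BFx.DegreeSevenCount` — road «BF-x» for binder row D1, leaf A2: THE DEGREE-≥-7 CORRECTIONS ARE `O(1)`,
# UNIFORMLY IN THE BLOCK SIZE — a leg monomial of total decay degree `≥ 7` times the (1.22)-moment weight `w_μw_ν` is a
# QUINTIC kernel (`≤ C/‖w‖∞⁵` shellwise), its punctured partial sums converge ABSOLUTELY (no massive tail needed) and
# `|fullSum| ≤ 160·C` for every `(L, k)` / every block size

HONEST FRAMING (cell contract, verbatim): «discharging `BetaPertH` makes Bałaban's UV stability UNCONDITIONAL — a real constructive-QFT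
result; it is NOT the continuum limit and NOT the Clay problem.»  This module is [folklore] lattice power counting in `ℤ⁴` composed BY
NAME from the tree (`TransferUV.abs_sum_le_of_quintic`, `TransferUV.card_annulus_succ_four_le`, `DyadicShell.sum_Ico_shellSum`,
`WindowLog.shellSum`, `WindowIdentification.psum/fullSum/fullSum_eq_of_tendsto/abs_fullSum_sub_psum_le`, `BubbleTransfer.Leg.abs_f_le`,
`BubbleTransfer.abs_moment_le`).  It cites nothing, mints no `Prop`, discharges nothing of the wall; NOT summit progress; NOT continuum,
NOT Clay.  HONEST DEPENDENCY (verbatim): continuum YM on T⁴ ⇐ BetaPertH ∧ nine spine estimates (0/9 proved); BetaPertH ⇐ (D1) ∧ (D4) ∧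
CAP+tail; G-an2-4 gates asym, D1 and NE2/3/4.

WHY (skeleton `HOME/beta/skeletons/D1-b2b-balaban-beta-d1-p2.md` v1.4 node A, leaf A2 «DEGREE ≥ 7 CORRECTIONS: O(1) uniformly:
`Σ_{0<‖w‖≤n} ‖w‖²·‖w‖^{−7}·#shell(‖w‖) ≤ C` (d = 4: shell ∼ r³)»; claim table `HOME/b2b-balaban-beta-d1-p2/LEAVES-BFx.md` row A2).
Leaf A1.ii writes the MAIN term of the weighted one-shot kernel `w_μw_ν·P_n(b, b+w)` off the contact set as the realised table `stK`
over the actual scalar leg PLUS a finite sum of leg monomials of total degree `≥ 7` (`BubbleTransfer.product_transfer`: the product of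
two legs of total degree `6` equals the product of their continuum parts up to ONE POWER BETTER).  With the moment weight
`|w_μw_ν| ≤ ‖w‖∞²` such a monomial is `≤ C·‖w‖∞^{−5}` shellwise; in `d = 4` (`#shell ≤ 80(r+1)³`) its shell sums are `≤ 80C(r+1)⁻²`,
so — unlike the marginal MAIN term (`‖w‖∞⁻⁴`, shell sums `∼ (r+1)⁻¹`, window `∼ log n` = the drift) and unlike the block-structured
REST terms of leaf A3 (which need the SCALED count `D1BFx/ScaledWindowCount` and a massive tail) — the degree-≥-7 corrections have
ABSOLUTELY CONVERGENT punctured lattice sums bounded by `160·C` with NO reference to the block size at all.  Nothing about Bałaban's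
kernels is asserted: `K` is an arbitrary function `ℤ⁴ → ℝ`, the legs are arbitrary shellwise-bounded functions.

CONTENT (all [folklore]).
* §1 `sum_Ico_inv_sq_le_sub`, `sum_Ico_inv_sq_le` — the tail of the square series: `Σ_{R≤r<R′} (r+1)⁻² ≤ 2/(R+1) − 2/(R′+1) ≤ 2/(R+1)`.
* §2 quintic kernels: `abs_shellSum_le_of_quintic` (`≤ 80C(r+1)⁻²`), `abs_psum_le_of_quintic` (`≤ 160C`, every radius),
  `abs_psum_sub_psum_le_of_quintic` (`≤ 160C/(R+1)`), `cauchySeq_psum_of_quintic`, `tendsto_fullSum_of_quintic`,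
  `abs_fullSum_sub_psum_le_of_quintic`, **`abs_fullSum_le_of_quintic`** (`|fullSum K| ≤ 160C`).
* §3 `abs_fullSum_le_of_quinticWindow` — the mixed form in the frame of `ScaledWindowCount`: quintic only on the window `r+1 ≤ n`,
  the standard scale-`n` massive tail beyond ⇒ `|fullSum K| ≤ 160C + 80E(1 + 1/δ)`, `n`-free.
* §4 leg monomials: `abs_moment_monomial_le_of_degree` (shellwise `|w_μw_ν·Σ c_iF_iG_i| ≤ (Σ|c_i|R_iS_i)(r+1)⁻⁵` when
  `a_i + b_i ≥ 7`), **`abs_fullSum_moment_monomial_le`** (uniformly in the family parameter `n`),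
  **`abs_fullSum_moment_lattBubble_le_of_seven_le_degree`** (for `BubbleTransfer.Leg` tables of total degree `≥ 7`: `≤ 160·Σ|c_i|(A+B)(A′+B′)`
  for EVERY `(L, k)`).
-/

namespace Summit.QuantumFields.BalabanUV.Beta.D1BFx.DegreeSevenCount

open Finset Filter Topology
open scoped BigOperators
open Literature.Probability.LatticeModels (annulus)
open Literature.MathematicalPhysics.QuantumFieldTheory.Balaban1983to89
open Literature.MathematicalPhysics.QuantumFieldTheory.Balaban1983to89.Beta
open DyadicShell (Pt toReal supNorm sum_Ico_shellSum supNorm_eq_of_mem_sphere ne_zero_of_mem_annulus mem_annulus_iff)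
open WindowLog (shellSum)
open WindowIdentification (psum fullSum fullSum_eq_of_tendsto tendsto_fullSum abs_fullSum_sub_psum_le)
open TransferUV (card_annulus_succ_four_le abs_sum_le_of_quintic)
open BubbleTransfer (Leg lattBubble abs_moment_le)

/-! ## §1 The tail of the square series -/

/-- [folklore] The telescoped tail of the square series: `Σ_{R ≤ r < R′} 1/(r+1)² ≤ 2/(R+1) − 2/(R′+1)`
(termwise `(r+1)⁻² ≤ 2/(r+1) − 2/(r+2)`). -/
theorem sum_Ico_inv_sq_le_sub {R R' : ℕ} (h : R ≤ R') :
    ∑ r ∈ Finset.Ico R R', 1 / ((r : ℝ) + 1) ^ 2 ≤ 2 / ((R : ℝ) + 1) - 2 / ((R' : ℝ) + 1) := by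
  induction R', h using Nat.le_induction with
  | base => simp
  | succ R' hRR' ih =>
    rw [Finset.sum_Ico_succ_top hRR']
    have h0 : (0 : ℝ) < (R' : ℝ) + 1 := by positivity
    have step : 1 / ((R' : ℝ) + 1) ^ 2 ≤ 2 / ((R' : ℝ) + 1) - 2 / (((R' + 1 : ℕ) : ℝ) + 1) := by
      push_cast
      rw [div_sub_div _ _ h0.ne' (by positivity), div_le_div_iff₀ (by positivity) (by positivity)]
      nlinarith
    linarith

/-- [folklore] `Σ_{R ≤ r < R′} 1/(r+1)² ≤ 2/(R+1)`. -/
theorem sum_Ico_inv_sq_le {R R' : ℕ} (h : R ≤ R') :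
    ∑ r ∈ Finset.Ico R R', 1 / ((r : ℝ) + 1) ^ 2 ≤ 2 / ((R : ℝ) + 1) := by
  have h1 := sum_Ico_inv_sq_le_sub h
  have h2 : (0 : ℝ) ≤ 2 / ((R' : ℝ) + 1) := by positivity
  linarith

/-! ## §2 Quintic kernels: shell sums, window sums, absolute convergence of the punctured full sum -/

section Quintic

variable {K : Pt → ℝ} {C : ℝ}

/-- [folklore] **ONE SHELL.**  `|K w| ≤ C/(r+1)⁵` on the shell `‖w‖∞ = r+1` gives `|shellSum K r| ≤ 80C/(r+1)²` (`#shell ≤ 80(r+1)³`). -/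
theorem abs_shellSum_le_of_quintic (hC : 0 ≤ C) (hr : ∀ r, ∀ w ∈ annulus 4 r (r + 1), |K w| ≤ C / ((r : ℝ) + 1) ^ 5) (r : ℕ) :
    |shellSum K r| ≤ 80 * C / ((r : ℝ) + 1) ^ 2 := by
  have hr0 : (0 : ℝ) < (r : ℝ) + 1 := by positivity
  rw [shellSum]
  calc |∑ w ∈ annulus 4 r (r + 1), K w| ≤ ∑ w ∈ annulus 4 r (r + 1), |K w| := Finset.abs_sum_le_sum_abs _ _
    _ ≤ ∑ _w ∈ annulus 4 r (r + 1), C / ((r : ℝ) + 1) ^ 5 := Finset.sum_le_sum fun w hw => hr r w hw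
    _ = ((annulus 4 r (r + 1)).card : ℝ) * (C / ((r : ℝ) + 1) ^ 5) := by rw [Finset.sum_const, nsmul_eq_mul]
    _ ≤ 80 * ((r : ℝ) + 1) ^ 3 * (C / ((r : ℝ) + 1) ^ 5) :=
        mul_le_mul_of_nonneg_right (card_annulus_succ_four_le r) (by positivity)
    _ = 80 * C / ((r : ℝ) + 1) ^ 2 := by field_simp

/-- [folklore] **THE WINDOW, ANY RADIUS.**  `|psum K R| ≤ 160·C` for every `R` (`TransferUV.abs_sum_le_of_quintic` in `psum` form: `Σ(r+1)⁻² ≤ 2`). -/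
theorem abs_psum_le_of_quintic (hC : 0 ≤ C) (hr : ∀ r, ∀ w ∈ annulus 4 r (r + 1), |K w| ≤ C / ((r : ℝ) + 1) ^ 5) (R : ℕ) :
    |psum K R| ≤ 160 * C := by
  rw [psum]
  exact abs_sum_le_of_quintic hC hr

/-- [folklore] **THE TAIL WITHOUT A MASS.**  `|psum K R′ − psum K R| ≤ 160C/(R+1)` for `R ≤ R′`: the shells from `R` on contribute
`Σ_{r≥R} 80C(r+1)⁻² ≤ 160C/(R+1)`. -/
theorem abs_psum_sub_psum_le_of_quintic (hC : 0 ≤ C) (hr : ∀ r, ∀ w ∈ annulus 4 r (r + 1), |K w| ≤ C / ((r : ℝ) + 1) ^ 5)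
    {R R' : ℕ} (hRR' : R ≤ R') : |psum K R' - psum K R| ≤ 160 * C / ((R : ℝ) + 1) := by
  rw [WindowIdentification.psum_sub_psum K hRR', ← sum_Ico_shellSum K hRR']
  calc |∑ r ∈ Finset.Ico R R', shellSum K r| ≤ ∑ r ∈ Finset.Ico R R', |shellSum K r| := Finset.abs_sum_le_sum_abs _ _
    _ ≤ ∑ r ∈ Finset.Ico R R', 80 * C / ((r : ℝ) + 1) ^ 2 := Finset.sum_le_sum fun r _ => abs_shellSum_le_of_quintic hC hr r
    _ = 80 * C * ∑ r ∈ Finset.Ico R R', 1 / ((r : ℝ) + 1) ^ 2 := by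
        rw [Finset.mul_sum]; refine Finset.sum_congr rfl fun r _ => ?_; ring
    _ ≤ 80 * C * (2 / ((R : ℝ) + 1)) := mul_le_mul_of_nonneg_left (sum_Ico_inv_sq_le hRR') (by positivity)
    _ = 160 * C / ((R : ℝ) + 1) := by ring

/-- [folklore] **The punctured partial sums of a quintic kernel are Cauchy** (absolute convergence; no exponential tail is used). -/
theorem cauchySeq_psum_of_quintic (hC : 0 ≤ C) (hr : ∀ r, ∀ w ∈ annulus 4 r (r + 1), |K w| ≤ C / ((r : ℝ) + 1) ^ 5) :
    CauchySeq (psum K) := by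
  refine Metric.cauchySeq_iff'.mpr fun ε hε => ?_
  obtain ⟨N₀, hN₀⟩ := exists_nat_gt (160 * C / ε)
  refine ⟨N₀, fun n hn => ?_⟩
  have hNpos : (0 : ℝ) < (N₀ : ℝ) + 1 := by positivity
  rw [Real.dist_eq]
  calc |psum K n - psum K N₀| ≤ 160 * C / ((N₀ : ℝ) + 1) := abs_psum_sub_psum_le_of_quintic hC hr hn
    _ < ε := by
        rw [div_lt_iff₀ hNpos]
        calc 160 * C = 160 * C / ε * ε := by field_simp
          _ < ((N₀ : ℝ) + 1) * ε := mul_lt_mul_of_pos_right (by linarith) hε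
          _ = ε * ((N₀ : ℝ) + 1) := mul_comm _ _

/-- [folklore] Hence they converge, … -/
theorem exists_tendsto_psum_of_quintic (hC : 0 ≤ C) (hr : ∀ r, ∀ w ∈ annulus 4 r (r + 1), |K w| ≤ C / ((r : ℝ) + 1) ^ 5) :
    ∃ B : ℝ, Tendsto (psum K) atTop (𝓝 B) :=
  cauchySeq_tendsto_of_complete (cauchySeq_psum_of_quintic hC hr)

/-- [folklore] … to `fullSum K`. -/
theorem tendsto_fullSum_of_quintic (hC : 0 ≤ C) (hr : ∀ r, ∀ w ∈ annulus 4 r (r + 1), |K w| ≤ C / ((r : ℝ) + 1) ^ 5) :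
    Tendsto (psum K) atTop (𝓝 (fullSum K)) :=
  tendsto_fullSum (exists_tendsto_psum_of_quintic hC hr)

/-- [folklore] **Quantitative rate**: `|fullSum K − psum K R| ≤ 160C/(R+1)` for every `R`. -/
theorem abs_fullSum_sub_psum_le_of_quintic (hC : 0 ≤ C) (hr : ∀ r, ∀ w ∈ annulus 4 r (r + 1), |K w| ≤ C / ((r : ℝ) + 1) ^ 5)
    (R : ℕ) : |fullSum K - psum K R| ≤ 160 * C / ((R : ℝ) + 1) := by
  have hlim : Tendsto (fun n => |psum K n - psum K R|) atTop (𝓝 |fullSum K - psum K R|) :=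
    ((tendsto_fullSum_of_quintic hC hr).sub_const _).abs
  refine le_of_tendsto hlim ?_
  filter_upwards [eventually_ge_atTop R] with n hn
  exact abs_psum_sub_psum_le_of_quintic hC hr hn

/-- [folklore] **ONE POWER BETTER THAN MARGINAL HAS A BOUNDED FULL SUM**: `|fullSum K| ≤ 160·C` — the leaf-A2 count
`Σ_{w≠0} ‖w‖²·‖w‖⁻⁷ ≲ Σ_r 80(r+1)³(r+1)⁻⁵ ≤ 160`. -/
theorem abs_fullSum_le_of_quintic (hC : 0 ≤ C) (hr : ∀ r, ∀ w ∈ annulus 4 r (r + 1), |K w| ≤ C / ((r : ℝ) + 1) ^ 5) :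
    |fullSum K| ≤ 160 * C := by
  have hlim : Tendsto (fun n => |psum K n|) atTop (𝓝 |fullSum K|) := (tendsto_fullSum_of_quintic hC hr).abs
  exact le_of_tendsto' hlim fun R => abs_psum_le_of_quintic hC hr R

end Quintic

/-! ## §3 The mixed form (frame of `D1BFx/ScaledWindowCount`): quintic on the window, massive tail beyond the block scale -/

/-- [folklore] **WINDOW + TAIL ⇒ A BLOCK-SIZE-UNIFORM FULL SUM.**  If `|K w| ≤ C/(r+1)⁵` on the shells `r + 1 ≤ n` and the standard
scale-`n` massive tail `|K w| ≤ E/(r+1)⁴·e^{−(δ/n)(r+1)}` holds from `r ≥ n − 1` on, then `|fullSum K| ≤ 160·C + 80·E·(1 + 1/δ)` —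
INDEPENDENT OF `n` (window by `TransferUV.abs_sum_le_of_quintic` at radius `n − 1`, tail by `WindowIdentification.abs_fullSum_sub_psum_le`
at `M := n − 1`, `Lr := n`: `80E(1 + n/δ)/n ≤ 80E(1 + 1/δ)`). -/
theorem abs_fullSum_le_of_quinticWindow {K : Pt → ℝ} {n : ℕ} (hn : 1 ≤ n) {C E δ : ℝ} (hC : 0 ≤ C) (hE : 0 ≤ E) (hδ : 0 < δ)
    (hwin : ∀ r : ℕ, r + 1 ≤ n → ∀ w ∈ annulus 4 r (r + 1), |K w| ≤ C / ((r : ℝ) + 1) ^ 5)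
    (htail : ∀ r : ℕ, n - 1 ≤ r → ∀ w ∈ annulus 4 r (r + 1), |K w| ≤ E / ((r : ℝ) + 1) ^ 4 * Real.exp (-(δ / (n : ℝ)) * ((r : ℝ) + 1))) :
    |fullSum K| ≤ 160 * C + 80 * E * (1 + 1 / δ) := by
  have hn0 : (0 : ℝ) < (n : ℝ) := by exact_mod_cast hn
  -- the window: truncate `K` beyond radius `n − 1`; the truncation is quintic on every shell and agrees with `K` on the window
  have hwindow : |psum K (n - 1)| ≤ 160 * C := by
    set K' : Pt → ℝ := fun w => if supNorm w ≤ n - 1 then K w else 0 with hK'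
    have hK'q : ∀ r, ∀ w ∈ annulus 4 r (r + 1), |K' w| ≤ C / ((r : ℝ) + 1) ^ 5 := by
      intro r w hw
      simp only [hK']
      split_ifs with h
      · have hs := supNorm_eq_of_mem_sphere hw
        exact hwin r (by omega) w hw
      · rw [abs_zero]; positivity
    have heq : psum K (n - 1) = psum K' (n - 1) := by
      rw [psum, psum]
      refine Finset.sum_congr rfl fun w hw => ?_
      have h2 := (mem_annulus_iff.mp hw).2
      simp only [hK', if_pos h2]
    rw [heq]
    exact abs_psum_le_of_quintic hC hK'q (n - 1)
  have htail' := abs_fullSum_sub_psum_le (K := K) (M := n - 1) hE hδ hn0 htail le_rfl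
  have hM : (((n - 1 : ℕ) : ℝ) + 1) = (n : ℝ) := by
    rw [Nat.cast_sub hn, Nat.cast_one]; ring
  rw [hM] at htail'
  have htail'' : |fullSum K - psum K (n - 1)| ≤ 80 * E * (1 + 1 / δ) := by
    refine htail'.trans ?_
    rw [div_le_iff₀ hn0]
    have h1 : (1 : ℝ) ≤ n := by exact_mod_cast hn
    have h2 : 80 * E ≤ 80 * E * (n : ℝ) := le_mul_of_one_le_right (by positivity) h1
    have h3 : 80 * E * (1 + (n : ℝ) / δ) = 80 * E + 80 * E / δ * n := by ring
    have h4 : 80 * E * (1 + 1 / δ) * (n : ℝ) = 80 * E * n + 80 * E / δ * n := by ring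
    rw [h3, h4]
    linarith
  calc |fullSum K| = |(fullSum K - psum K (n - 1)) + psum K (n - 1)| := by rw [sub_add_cancel]
    _ ≤ |fullSum K - psum K (n - 1)| + |psum K (n - 1)| := abs_add_le _ _
    _ ≤ 80 * E * (1 + 1 / δ) + 160 * C := add_le_add htail'' hwindow
    _ = 160 * C + 80 * E * (1 + 1 / δ) := by ring

/-! ## §4 Leg monomials of total degree `≥ 7` are quintic after the moment weight -/

section Monomial

variable {ι : Type*} {s : Finset ι} {c : ι → ℝ}

/-- [folklore] **ONE SHELL POINT.**  On the shell `‖w‖∞ = r+1`, bounds `|F_i| ≤ R_i(r+1)^{−a_i}`, `|G_i| ≤ S_i(r+1)^{−b_i}` with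
`a_i + b_i ≥ 7` give `|w_μw_ν·Σ_i c_iF_iG_i| ≤ (Σ_i |c_i|R_iS_i)·(r+1)⁻⁵` (the moment weight costs two powers, `BubbleTransfer.abs_moment_le`). -/
theorem abs_moment_monomial_le_of_degree {a b : ι → ℕ} (hdeg : ∀ i ∈ s, 7 ≤ a i + b i) (μ ν : Fin 4) {r : ℕ} {w : Pt}
    (hw : w ∈ annulus 4 r (r + 1)) {F G R S : ι → ℝ} (hR : ∀ i ∈ s, 0 ≤ R i) (hS : ∀ i ∈ s, 0 ≤ S i)
    (hF : ∀ i ∈ s, |F i| ≤ R i / ((r : ℝ) + 1) ^ a i) (hG : ∀ i ∈ s, |G i| ≤ S i / ((r : ℝ) + 1) ^ b i) :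
    |toReal w μ * toReal w ν * ∑ i ∈ s, c i * (F i * G i)| ≤ (∑ i ∈ s, |c i| * (R i * S i)) / ((r : ℝ) + 1) ^ 5 := by
  have hr1 : (1 : ℝ) ≤ (r : ℝ) + 1 := by
    have := (Nat.cast_nonneg r : (0 : ℝ) ≤ r); linarith
  have hr0 : (0 : ℝ) < (r : ℝ) + 1 := by positivity
  have hsup : (supNorm w : ℝ) = (r : ℝ) + 1 := by rw [supNorm_eq_of_mem_sphere hw]; push_cast; ring
  have hmom : |toReal w μ * toReal w ν| ≤ ((r : ℝ) + 1) ^ 2 := by rw [← hsup]; exact abs_moment_le μ ν w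
  have hsum : |∑ i ∈ s, c i * (F i * G i)| ≤ (∑ i ∈ s, |c i| * (R i * S i)) / ((r : ℝ) + 1) ^ 7 := by
    rw [Finset.sum_div]
    refine (Finset.abs_sum_le_sum_abs _ _).trans (Finset.sum_le_sum fun i hi => ?_)
    have hRi := hR i hi
    have hSi := hS i hi
    rw [abs_mul, abs_mul]
    calc |c i| * (|F i| * |G i|) ≤ |c i| * (R i / ((r : ℝ) + 1) ^ a i * (S i / ((r : ℝ) + 1) ^ b i)) := by
          refine mul_le_mul_of_nonneg_left ?_ (abs_nonneg _)
          exact mul_le_mul (hF i hi) (hG i hi) (abs_nonneg _) (by positivity)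
      _ = |c i| * (R i * S i) / ((r : ℝ) + 1) ^ (a i + b i) := by rw [pow_add]; field_simp
      _ ≤ |c i| * (R i * S i) / ((r : ℝ) + 1) ^ 7 := by
          apply div_le_div_of_nonneg_left (by positivity) (by positivity)
          exact pow_le_pow_right₀ hr1 (hdeg i hi)
  have hEnn : 0 ≤ (∑ i ∈ s, |c i| * (R i * S i)) / ((r : ℝ) + 1) ^ 7 := le_trans (abs_nonneg _) hsum
  rw [abs_mul]
  calc |toReal w μ * toReal w ν| * |∑ i ∈ s, c i * (F i * G i)|
      ≤ ((r : ℝ) + 1) ^ 2 * ((∑ i ∈ s, |c i| * (R i * S i)) / ((r : ℝ) + 1) ^ 7) :=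
        mul_le_mul hmom hsum (abs_nonneg _) (by positivity)
    _ = (∑ i ∈ s, |c i| * (R i * S i)) / ((r : ℝ) + 1) ^ 5 := by field_simp

/-- [folklore] **LEAF A2, ABSTRACT LEGS — UNIFORMLY IN THE FAMILY PARAMETER.**  For a family (parameter `n`: block size, `(L,k)`, …) of
weighted leg monomials `K_n(w) = w_μw_ν·Σ_i c_i·F′_i(n,w)·G′_i(n,w)` whose legs obey, for EVERY `n`, the shellwise bounds
`|F′_i(n,w)| ≤ R_i‖w‖∞^{−a_i}`, `|G′_i(n,w)| ≤ S_i‖w‖∞^{−b_i}` with `n`-FREE constants and total degree `a_i + b_i ≥ 7`: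
`|fullSum K_n| ≤ 160·Σ_i |c_i|R_iS_i` for every `n`. -/
theorem abs_fullSum_moment_monomial_le {a b : ι → ℕ} (hdeg : ∀ i ∈ s, 7 ≤ a i + b i) (μ ν : Fin 4)
    {F' G' : ι → ℕ → Pt → ℝ} {R S : ι → ℝ} (hR : ∀ i ∈ s, 0 ≤ R i) (hS : ∀ i ∈ s, 0 ≤ S i)
    (hF : ∀ i ∈ s, ∀ n r, ∀ w ∈ annulus 4 r (r + 1), |F' i n w| ≤ R i / ((r : ℝ) + 1) ^ a i)
    (hG : ∀ i ∈ s, ∀ n r, ∀ w ∈ annulus 4 r (r + 1), |G' i n w| ≤ S i / ((r : ℝ) + 1) ^ b i) (n : ℕ) :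
    |fullSum (fun w => toReal w μ * toReal w ν * ∑ i ∈ s, c i * (F' i n w * G' i n w))| ≤
      160 * ∑ i ∈ s, |c i| * (R i * S i) := by
  have hC : 0 ≤ ∑ i ∈ s, |c i| * (R i * S i) :=
    Finset.sum_nonneg fun i hi => mul_nonneg (abs_nonneg _) (mul_nonneg (hR i hi) (hS i hi))
  exact abs_fullSum_le_of_quintic hC fun r w hw =>
    abs_moment_monomial_le_of_degree hdeg μ ν hw hR hS (fun i hi => hF i hi n r w hw) (fun i hi => hG i hi n r w hw)

/-- [folklore] **LEAF A2 FOR `BubbleTransfer.Leg` TABLES.**  A table of leg pairs of total degree `≥ 7` (`7 ≤ a_{P_i} + a_{Q_i}`; each lattice leg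
is `≤ (A+B)‖w‖∞^{−a}` by `Leg.abs_f_le`, constants free of `(L,k)`) has, for EVERY `(L, k)`,
`|fullSum (w ↦ w_μw_ν·lattBubble(L,k;w))| ≤ 160·Σ_i |c_i|(A_{P_i}+B_{P_i})(A_{Q_i}+B_{Q_i})` — whereas total degree `6` is the window
logarithm (`BubbleTransfer.window_split`, `WindowInterface`). -/
theorem abs_fullSum_moment_lattBubble_le_of_seven_le_degree {P Q : ι → Leg} (hdeg : ∀ i ∈ s, 7 ≤ (P i).a + (Q i).a)
    (μ ν : Fin 4) (L k : ℕ) :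
    |fullSum (fun w => toReal w μ * toReal w ν * lattBubble s c P Q L k w)| ≤
      160 * ∑ i ∈ s, |c i| * (((P i).A + (P i).B) * ((Q i).A + (Q i).B)) := by
  have hshell : ∀ (T : Leg) (r : ℕ) (w : Pt), w ∈ annulus 4 r (r + 1) → |T.f L k w| ≤ (T.A + T.B) / ((r : ℝ) + 1) ^ T.a := by
    intro T r w hw
    have h := T.abs_f_le L k (ne_zero_of_mem_annulus hw)
    have hsup : (supNorm w : ℝ) = (r : ℝ) + 1 := by rw [supNorm_eq_of_mem_sphere hw]; push_cast; ring
    rwa [hsup] at h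
  have hC : 0 ≤ ∑ i ∈ s, |c i| * (((P i).A + (P i).B) * ((Q i).A + (Q i).B)) := Finset.sum_nonneg fun i _ => by
    have := (P i).nonneg_A; have := (P i).nonneg_B; have := (Q i).nonneg_A; have := (Q i).nonneg_B
    positivity
  refine abs_fullSum_le_of_quintic hC fun r w hw => ?_
  simp only [lattBubble]
  exact abs_moment_monomial_le_of_degree (a := fun i => (P i).a) (b := fun i => (Q i).a) hdeg μ ν hw
    (fun i _ => add_nonneg (P i).nonneg_A (P i).nonneg_B) (fun i _ => add_nonneg (Q i).nonneg_A (Q i).nonneg_B)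
    (fun i _ => hshell (P i) r w hw) (fun i _ => hshell (Q i) r w hw)

end Monomial

end Summit.QuantumFields.BalabanUV.Beta.D1BFx.DegreeSevenCount
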